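import Summits.BirchSwinnertonDyer.BirchSwinnertonDyer.Theorems.SignedLowerHalvesSmallImageLowerHalfBothSignsRttJunctionShaSemilocTwoLayer
import Summits.BirchSwinnertonDyer.BirchSwinnertonDyer.Theorems.SignedLowerHalvesSmallImageLowerHalfBothSignsRttD2SeqSemilocMap
import HarnessLib

/-!
# Route `SignedLowerHalves`, crux L `SmallImageLowerHalfBothSigns` (stmt-BirchSwinnertonDyer-23599), line `rtt_w3` v29 — stub S3α (`stub_junctionSha_ns`, row J4),
# brick ρ₂ (part 2): THE DEGREE-2 SEMILOCALISATION `ρ₂ = sloc²_P : I₂.H →ₗ[Λ_𝒪] Π_{w ∈ P} 𝐇²_{Iw,w}` OF honda's `𝐇²_{Iw,P}(K_∞, T*)` INTO THE SEMILOCAL IWASAWA MODULES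

INPUTS hand `bsd-inputs-honda-p1` g28 under LEAD `cruxlead-stmt-BirchSwinnertonDyer-23599` g14 (cell `bsd-ssimc`; TAKE-GRANT 2026-08-31T06:30Z); helper `--supports stmt-BirchSwinnertonDyer-23599`.
DEFINITIONS WITH BODIES (`semilocMap₂`, `semilocMapPi₂`) + THEOREMS; no named fact, no instance, no `sorry`. Sequel of part 1 (`…RttJunctionShaSemilocTwoLayer`: `semilocNKq` and its laws)
and the degree-2 twin of -w3's T2 (`SmallImageRttD2Seq.semilocMap`, `semilocMapPi`, degree 1).
WHY. In LEAD g14's Ш²-sequence socket `lambdaInvariant_le_of_sha_range(_restrictScalars)` (p812938) for row S3α, `ρ = ρ₂ : G = I₂.H → Loc = Π_{w∈P} (L₂ w).H` with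
`I₂ : CycIwasawaCohomologyDataO S κ γ θ′ P 2` (honda's `𝐇²_{Iw,P}`, the target of α1's `sp²`) and `L₂ w : SemilocIwasawaCohomologyDataO S κ γ θ′ P w 2` (-w3's semilocal datum, degree 2);
`ker ρ₂` plays the part of `Ш²_{Iw}` (α3 tautological) and α5′ proves `ker ρ₂ ≤ range π` for the tower Poitou–Tate map `π`; α2 proves `range ρ₂` finite.
HONEST FRAMING: this is the MAP only (existence, `Λ_𝒪`-linearity, levelwise pins, kernel criterion); nothing about S3α, E2, crux L or BSD is proved; all remain OPEN and are proved for NO curve.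

* §1 `semilocNK₂_smulΛ` — `sloc²_{w,n,k}` is `Λ_𝒪`-linear for the forced level structures (`cycLayerModuleO … (le_refl 2)` on `H²(G_P(K_n), X_k)`, `semilocLayerModuleΛ … 2` on `Lloc_w(n,k)²`):
  `𝒪`-linear (`semilocNKq_scalar`) and carries `conj_γ − 1` to `R_γ − 1` (`semilocNK₂_conj`), so Kaplansky §19 (a) applies.
* §2 ★ `semilocMap₂ hNP I₂ L₂ : I₂.H →ₗ[Λ_𝒪] L₂.H` (levelwise `semilocNKq 2`, glued by (P3)/(P4), `Λ_𝒪`-linear by the two rigidities), `proj_semilocMap₂`, uniqueness, `semilocMap₂_eq_zero_iff`.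
* §3 ★★ `semilocMapPi₂ hNP S₀ I₂ L₂ : I₂.H →ₗ[Λ_𝒪] Π_{w : S₀} (L₂ w).H` = **ρ₂** (take `S₀ = P`), `semilocMapPi₂_apply`, ★★ `mem_ker_semilocMapPi₂_iff` (`ρ₂ b = 0 ↔ ∀ w ∈ S₀, ∀ n k, sloc²_{w,n,k}(proj n k b) = 0`)
  and ★★ `mem_ker_semilocMapPi₂_iff_forall_loc` (`↔` every localisation `loc²_{n,w}(conj_δ (proj n k b))` at every place above `S₀` of every layer vanishes — the levelwise description of
  `Ш²` that α5′ consumes).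
References: [Kaplansky1954] §19; [Kato2004Asterisque] §8.2, §17.13; [NeukirchSchmidtWingberg2008] (8.6.2)–(8.6.3); [Rubin2000] Thm. 1.7.3, App. B.3; [Lang1990] Ch. 5 §1.
-/

set_option autoImplicit false
set_option linter.dupNamespace false -- D-0017: single-problem summit, the namespace repeats the problem name by design
noncomputable section

open scoped Classical PowerSeries
open NumberField IsDedekindDomain Field CategoryTheory Function

namespace Summit.BirchSwinnertonDyer.BirchSwinnertonDyer.Theorems.SmallImageRttJunctionSha

open Literature.NumberTheory.EllipticCurves Literature.NumberTheory.GaloisRepresentations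
  Literature.NumberTheory.ComplexMultiplication.EllipticUnits.JohnsonLeungKings2011
  Literature.Algebra.Module.LocallyNilpotent
  Summit.BirchSwinnertonDyer.BirchSwinnertonDyer.Theorems.SmallImageRttD2J1
  Summit.BirchSwinnertonDyer.BirchSwinnertonDyer.Theorems.SmallImageRttD2J2
  Summit.BirchSwinnertonDyer.BirchSwinnertonDyer.Theorems.SmallImageRttD2Seq

/-! ## §1. The degree-2 semilocalisation of a level is `Λ_𝒪`-linear for the forced structures -/

section LevelLinear

variable {K : Type} [Field K] [NumberField K] {p : ℕ} [Fact p.Prime] (S : Set (PadicAlgCl p)) (κ : ZpExtension K p) (γ : absoluteGaloisGroup K)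
  (θ' : absoluteGaloisGroup K →ₜ* (padicCoeffIntegers S)ˣ) (P : Set (HeightOneSpectrum (𝓞 K))) (w : HeightOneSpectrum (𝓞 K))

/-- **`sloc² (F • y) = F • sloc² y`** for `F ∈ Λ_𝒪` and the FORCED level structures (honda's `cycLayerModuleO … (le_refl 2)` on `H²(G_P(K_n), X_k)`, `semilocLayerModuleΛ … 2` on `Lloc_w(n,k)²`):
`sloc²` is `𝒪`-linear (`semilocNKq_scalar`) and carries `conj_γ − 1` to `R_γ − 1` (`semilocNK₂_conj`), so Kaplansky §19 (a) (`map_smul_of_comp_eq`) applies — the degree-2 twin of T2's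
`semilocNK_smulΛ`. [cite: Kaplansky1954, §19] [cite: Lang1990, Ch. 5 §1] -/
theorem semilocNK₂_smulΛ (n k : ℕ) (F : IwasawaAlgebraO S) (y : cycLayerCohO S κ θ' P n k 2) :
    semilocNKq S κ θ' P w 2 n k (letI := cycLayerModuleO S κ γ θ' P (le_refl 2) n k; F • y) =
      (letI := semilocLayerModuleΛ S κ γ θ' P w n k 2; F • semilocNKq S κ θ' P w 2 n k y) := by
  letI i0 := levelModuleO S P θ' (κ.layerSubgroup n) k 2
  letI i2 := cycLayerModuleO S κ γ θ' P (le_refl 2) n k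
  letI j0 := semilocModuleO S κ θ' P w n k 2
  letI j2 := semilocLayerModuleΛ S κ γ θ' P w n k 2
  obtain ⟨hC, hX⟩ := cycLayerModuleO_spec S κ γ θ' P (le_refl 2) n k
  obtain ⟨hC', hX'⟩ := semilocLayerModuleΛ_spec S κ γ θ' P w n k 2
  let f : cycLayerCohO S κ θ' P n k 2 →ₗ[padicCoeffIntegers S] semilocCoh S κ θ' P w n k 2 :=
    { toFun := semilocNKq S κ θ' P w 2 n k
      map_add' := map_add _
      map_smul' := fun c y ↦ by
        change semilocNKq S κ θ' P w 2 n k (cycLayerScalarO S κ θ' P n k 2 c y) = semilocScalar S κ θ' P w n k 2 c (semilocNKq S κ θ' P w 2 n k y)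
        exact semilocNKq_scalar S κ θ' P w 2 n k c y }
  exact map_smul_of_comp_eq hC hX hC' hX' (cycLayerPsiO_locallyNilpotent S κ γ θ' P n k (le_refl 2)) f
    (fun y ↦ by
      change semilocNKq S κ θ' P w 2 n k (cycLayerConjO S κ θ' P n k 2 γ y - y) =
        semilocConj S κ θ' P w n k 2 γ (semilocNKq S κ θ' P w 2 n k y) - semilocNKq S κ θ' P w 2 n k y
      rw [map_sub, semilocNK₂_conj]) F y

end LevelLinear

/-! ## §2. The degree-2 semilocalisation `sloc²_w : I₂.H →ₗ[Λ_𝒪] 𝐇²_{Iw,w}` -/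

section Map

variable {K : Type} [Field K] [NumberField K] {p : ℕ} [Fact p.Prime] {S : Set (PadicAlgCl p)} {κ : ZpExtension K p} {γ : absoluteGaloisGroup K}
  {θ' : absoluteGaloisGroup K →ₜ* (padicCoeffIntegers S)ˣ} {P : Set (HeightOneSpectrum (𝓞 K))} {w : HeightOneSpectrum (𝓞 K)}
  (hNP : ∀ n, ramificationSubgroup K P ≤ κ.layerSubgroup n)
  (I : CycIwasawaCohomologyDataO S κ γ θ' P 2) (L : SemilocIwasawaCohomologyDataO S κ γ θ' P w 2)

/-- The levelwise degree-2 semilocal family of a class of `𝐇²_{Iw,P}`: `(sloc²_{w,n,k} (proj n k b))_{n,k}`. [cite: Rubin2000, App. B.3] -/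
def semilocFamily₂ (b : I.H) : ∀ n k : ℕ, semilocCoh S κ θ' P w n k 2 := fun n k ↦ semilocNKq S κ θ' P w 2 n k (I.proj n k b)

include hNP in
/-- The family is compatible with the corestrictions (`N_P ≤ U_m`; part 1 `semilocNKq_cores`). [cite: NeukirchSchmidtWingberg2008, I §5 Prop. 1.5.4] -/
theorem semilocFamily₂_cores (b : I.H) (n k : ℕ) :
    semilocCores S κ θ' P w n k 2 (semilocFamily₂ I b (n + 1) k) = semilocFamily₂ I b n k := by
  unfold semilocFamily₂
  rw [← semilocNKq_cores S κ θ' P w hNP 2 n k, I.proj_cores]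

/-- The family is compatible with the reductions (part 1 `semilocNKq_red`). [cite: Kato2004Asterisque, §8.2 (p. 180)] -/
theorem semilocFamily₂_red (b : I.H) (n k : ℕ) :
    semilocRed S κ θ' P w n k 2 (semilocFamily₂ I b n (k + 1)) = semilocFamily₂ I b n k := by
  unfold semilocFamily₂
  rw [← semilocNKq_red S κ θ' P w 2 n k, I.proj_red]

include hNP in
/-- Existence of the lift of the family ((P4) of `L`). [cite: Kato2004Asterisque, §8.2 (p. 180)] -/
theorem exists_lift_semilocFamily₂ (b : I.H) : ∃ z : L.H, ∀ n k, L.proj n k z = semilocNKq S κ θ' P w 2 n k (I.proj n k b) :=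
  L.proj_surjective (semilocFamily₂ I b) (semilocFamily₂_cores hNP I b) (semilocFamily₂_red I b)

/-- ★ **THE DEGREE-2 SEMILOCALISATION `sloc²_w : I₂.H →ₗ[Λ_𝒪] 𝐇²_{Iw,w}`** of honda's `𝐇²_{Iw,P}(K_∞, T*)` into -w3's semilocal Iwasawa module at `w` in degree `2`: the unique map with
`proj n k (sloc²_w b) = sloc²_{w,n,k} (proj n k b)` for all `n, k` ((P4) lifts the compatible family, (P3) makes it unique and additive, the rigidities `proj_smul_eq_cycLayer_smul` /
`proj_smul_eq_layer_smul` + §1 make it `Λ_𝒪`-linear). Needs `N_P ≤ U_m` for all `m`. The degree-2 twin of T2's `semilocMap`.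
[cite: Rubin2000, Thm. 1.7.3, App. B.3] [cite: Kato2004Asterisque, §8.2, §17.13] [cite: NeukirchSchmidtWingberg2008, (8.6.2)] -/
def semilocMap₂ : I.H →ₗ[IwasawaAlgebraO S] L.H where
  toFun b := Classical.choose (exists_lift_semilocFamily₂ hNP I L b)
  map_add' b b' := by
    refine L.eq_of_forall_proj_eq fun n k ↦ ?_
    rw [Classical.choose_spec (exists_lift_semilocFamily₂ hNP I L (b + b')) n k, (L.proj n k).map_add,
      Classical.choose_spec (exists_lift_semilocFamily₂ hNP I L b) n k, Classical.choose_spec (exists_lift_semilocFamily₂ hNP I L b') n k,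
      (I.proj n k).map_add, (semilocNKq S κ θ' P w 2 n k).map_add]
  map_smul' F b := by
    refine L.eq_of_forall_proj_eq fun n k ↦ ?_
    rw [Classical.choose_spec (exists_lift_semilocFamily₂ hNP I L (F • b)) n k, RingHom.id_apply, L.proj_smul_eq_layer_smul n k,
      Classical.choose_spec (exists_lift_semilocFamily₂ hNP I L b) n k, proj_smul_eq_cycLayer_smul (le_refl 2) I n k F b,
      semilocNK₂_smulΛ]

/-- ★ `proj n k (sloc²_w b) = sloc²_{w,n,k} (proj n k b)`. [cite: Rubin2000, App. B.3] -/
theorem proj_semilocMap₂ (b : I.H) (n k : ℕ) : L.proj n k (semilocMap₂ hNP I L b) = semilocNKq S κ θ' P w 2 n k (I.proj n k b) :=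
  Classical.choose_spec (exists_lift_semilocFamily₂ hNP I L b) n k

/-- Uniqueness: any map with the levelwise property is `sloc²_w`. [folklore] -/
theorem eq_semilocMap₂_of_proj (f : I.H → L.H) (hf : ∀ b n k, L.proj n k (f b) = semilocNKq S κ θ' P w 2 n k (I.proj n k b)) (b : I.H) :
    f b = semilocMap₂ hNP I L b :=
  L.eq_of_forall_proj_eq fun n k ↦ by rw [hf, proj_semilocMap₂]

/-- ★★ `sloc²_w b = 0 ↔` every level class `sloc²_{w,n,k} (proj n k b)` vanishes ((P3)). [cite: NeukirchSchmidtWingberg2008, (8.6.2)–(8.6.3)] -/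
theorem semilocMap₂_eq_zero_iff (b : I.H) : semilocMap₂ hNP I L b = 0 ↔ ∀ n k, semilocNKq S κ θ' P w 2 n k (I.proj n k b) = 0 := by
  constructor
  · intro h n k
    rw [← proj_semilocMap₂ hNP I L b n k, h, map_zero]
  · intro h
    exact L.proj_injective _ fun n k ↦ by rw [proj_semilocMap₂, h n k]

end Map

/-! ## §3. `ρ₂ = sloc²_{S₀} : I₂.H →ₗ[Λ_𝒪] Π_{w ∈ S₀} 𝐇²_{Iw,w}` and its kernel -/

section Pi

variable {K : Type} [Field K] [NumberField K] {p : ℕ} [Fact p.Prime] {S : Set (PadicAlgCl p)} {κ : ZpExtension K p} {γ : absoluteGaloisGroup K}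
  {θ' : absoluteGaloisGroup K →ₜ* (padicCoeffIntegers S)ˣ} {P : Set (HeightOneSpectrum (𝓞 K))}
  (hNP : ∀ n, ramificationSubgroup K P ≤ κ.layerSubgroup n) (S₀ : Set (HeightOneSpectrum (𝓞 K)))
  (I : CycIwasawaCohomologyDataO S κ γ θ' P 2) (L : ∀ w : HeightOneSpectrum (𝓞 K), SemilocIwasawaCohomologyDataO S κ γ θ' P w 2)

/-- ★★ **`ρ₂ = sloc²_{S₀} : I₂.H →ₗ[Λ_𝒪] Π_{w∈S₀} 𝐇²_{Iw,w}`**, the product of the degree-2 semilocalisations at the places of `S₀` (row S3α: `S₀ = P = supp(p𝔣)`; the `ρ` of the Ш²-sequence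
socket `lambdaInvariant_le_of_sha_range`). [cite: Rubin2000, App. B.3] [cite: Kato2004Asterisque, §17.13] [cite: NeukirchSchmidtWingberg2008, (8.6.3), (8.6.10)] -/
def semilocMapPi₂ : I.H →ₗ[IwasawaAlgebraO S] (∀ w : S₀, (L w).H) :=
  LinearMap.pi fun w ↦ semilocMap₂ hNP I (L w)

/-- Components of `ρ₂`. [folklore] -/
theorem semilocMapPi₂_apply (b : I.H) (w : S₀) : semilocMapPi₂ hNP S₀ I L b w = semilocMap₂ hNP I (L w) b := rfl

/-- ★★ **`ker ρ₂` levelwise**: `ρ₂ b = 0 ↔` for every `w ∈ S₀` and every level `(n, k)`, `sloc²_{w,n,k} (proj n k b) = 0`. [cite: NeukirchSchmidtWingberg2008, (8.6.2)–(8.6.3)] [cite: Rubin2000, App. B.3] -/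
theorem mem_ker_semilocMapPi₂_iff (b : I.H) :
    b ∈ LinearMap.ker (semilocMapPi₂ hNP S₀ I L) ↔ ∀ w ∈ S₀, ∀ n k, semilocNKq S κ θ' P w 2 n k (I.proj n k b) = 0 := by
  rw [LinearMap.mem_ker]
  constructor
  · intro h w hw n k
    have hw' := congrFun h ⟨w, hw⟩
    rw [semilocMapPi₂_apply, Pi.zero_apply, semilocMap₂_eq_zero_iff] at hw'
    exact hw' n k
  · intro h
    funext w
    rw [semilocMapPi₂_apply, Pi.zero_apply, semilocMap₂_eq_zero_iff]
    exact h w w.2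

/-- ★★ **`ker ρ₂ = Ш²` levelwise, local form**: `ρ₂ b = 0 ↔` for every `w ∈ S₀`, every level `(n, k)` and every `δ ∈ Γ_K`, the localisation `loc²_{n,w}(conj_δ (proj n k b)) ∈ H²(U_{n,w}, X_k)`
vanishes — i.e. every level component of `b` is locally trivial at EVERY place of `K_n` above `S₀` (part 1 `semilocNK₂_eq_zero_iff`). This is the description of `ker ρ₂` that the tower
Poitou–Tate containment α5′ (`ker ρ₂ ≤ range π`) starts from. [cite: NeukirchSchmidtWingberg2008, I §5 (1.5.6)–(1.5.7), (8.6.3)] [cite: SerreLocalFields1979, VII §5] -/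
theorem mem_ker_semilocMapPi₂_iff_forall_loc (b : I.H) :
    b ∈ LinearMap.ker (semilocMapPi₂ hNP S₀ I L) ↔
      ∀ w ∈ S₀, ∀ (n k : ℕ) (δ : absoluteGaloisGroup K),
        ContinuousCohomology.map (locLayerHom κ P w n) (locLayerMod S κ θ' P w n k) 2 (cycLayerConjO S κ θ' P n k 2 δ (I.proj n k b)) = 0 := by
  rw [mem_ker_semilocMapPi₂_iff]
  refine forall_congr' fun w ↦ forall_congr' fun _ ↦ forall_congr' fun n ↦ forall_congr' fun k ↦ ?_
  rw [semilocNK₂_eq_zero_iff]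

end Pi

end Summit.BirchSwinnertonDyer.BirchSwinnertonDyer.Theorems.SmallImageRttJunctionSha

end
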